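import Mathlib
import HarnessLib
import Summits.NavierStokesRegularity.NavierStokesRegularity.Theorems.PoloidalWindowDoorLrcModEntireQ4SonicSheetSpeedClass
import Summits.NavierStokesRegularity.NavierStokesRegularity.Theorems.PoloidalWindowDoorLrcModEntireQ4SonicSheetSpeed
import Summits.NavierStokesRegularity.NavierStokesRegularity.Theorems.PoloidalWindowDoorLrcModEntireQ4SonicSheetNonHot
import Summits.NavierStokesRegularity.NavierStokesRegularity.Theorems.PoloidalWindowDoorLrcModEntireSheetTransport
import Summits.NavierStokesRegularity.NavierStokesRegularity.Theorems.PoloidalWindowDoorLrcModEntireRidgeWebDynamics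
import Summits.NavierStokesRegularity.NavierStokesRegularity.Theorems.PoloidalWindowDoorPoloidalWindowRigidityTimeHeightShearLinearSlice
import Summits.NavierStokesRegularity.NavierStokesRegularity.Theorems.PoloidalWindowDoorPoloidalWindowRigidityConstantShearSlice
import Summits.NavierStokesRegularity.NavierStokesRegularity.Theorems.LocalSineTubeDoorProfileAlignedWindowRigidityAncient

/-!
# Route `PoloidalWindowDoor`, item `LrcModEntire` (stmt-NavierStokesRegularity-20428), cell (Q4-sonic), slot `stub_Q4sonicLineNeg` —
# B-SPEED(τ), III (ASSEMBLY): THE WEB-SPEED LAW ON A NON-HOT SONIC SHEET OF PARALLEL LINES AT A GENERAL TIME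

Cell ns-regularity-ideate, helper seat ns-k2-port-2 g8 under the LEAD of item 20428 (ns-poloidal-K2-p3 g17, memo `T2B-g17.md` §5(5c)/(5g) «B-SPEEDτ (port-2 HS5; M):
the ∂_ν-differentiated vertical equation evaluated on a sonic web sheet of e-parallel lines at a general (non-hot) time»); `--supports stmt-NavierStokesRegularity-20428
--as helper`.

SETTING.  Class profile `U`; the (TH) slab law `∂_zU_b = μ(t,z)∂_bU₂` (`b = 0,1`) for `|t+1| < ρ`, `|x₂| < ρ` with a `C³` slope; a time `t = −1+τ`, `|τ| < 1/2`, `|τ| < ρ`;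
a horizontal unit vector `e`; an open height window `I ⊂ (−ρ,ρ)` and a `C^∞` offset `d` on `I`; the straight parallel web sheet `W(s,z) = s·e + d(z)·Je + z·e₂` at
time `t`, with `θ := U₂(t,·)`:
* (NON-HOT SONIC SHEET) `Dθ∘W ≡ c` on `ℝ × I`, a FIXED linear form killing horizontal vectors (i.e. `∇θ = (0,0,B)` along the sheet: horizontal criticality and
  `R(τ,·)` affine);
* (CHARACTERISTIC) `d′(z)² + μ(t,z) = 0` on `I` (Huygens at a sonic time);
* `a := D²θ(W)[Je,Je] ≠ 0` at the point considered.

RESULTS (every right-hand side explicit; `a₃ := D³θ(W)[Je,Je,Je]`, `u_J := u₁e₀ − u₀e₁ = u·Je`, `μ = μ(t,z)`, `μ_z = ∂_zμ(t,z)`, `d′ = d′(z)`):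
* ★ `sonic_sheet_normalDeriv_timeDeriv` — **`D(∂ₜU₂(t,·))(W)[Je] = (1+d′²)·a₃ − a·(U(t,W)_J − d′·U₂(t,W)) + 2μ_z·d′·a/(1−μ)`**, assembled from
  `…Q4SonicSheetSpeedClass.normalDeriv_timeDeriv_of_horizCritical` (source identity), `…Q4SonicSheetSpeed.laplacian_normalDeriv_of_sonicSheet` (`D(Δθ)[Je]`),
  `…Q4SonicSheetNonHot.nonhot_sheet_hessian_normalForm` / `…nonhot_sheet_null_tangents` / `…nonhot_sheet_thirdDeriv_ee_eq_zero` (rank-one Hessian, null tangents,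
  `D³θ[e,e,·] = 0`), `…SheetTransport.transport_on_characteristic_sheet` (`(d′a²)′ = 0`, fed by `plane_wave_identity` + incompressibility at time `t`);
* ★★ `sonic_sheet_speed_law` — with the kinematic sheet-speed law of normal speed `V` at `(τ, W)` (`…RidgeWebCurves.spacetimeHessian_sheetVelocity_normal_eq_zero`
  supplies it from the space–time web function) and `σ = ±1`: **`V·a = −(1+d′²)·a₃ + a·(U(t,W)_J − d′·U₂(t,W)) − 2μ_z·d′·a/(1−μ)`**
  (`…RidgeWebDynamics.sheetSpeed_eq_fderiv_timeDeriv`), i.e. LEAD's «`a·(U·Je − V) = (1−μ)·a₃ + (d′a·U₂ + 2d′aμ_z/(1−μ))`» after `1 + d′² = 1 − μ`.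
WHAT THIS IS NOT: not a claim about Navier–Stokes regularity — an identity of the (TH) column on a sonic web sheet (bears on the research slot `stub_Q4sonicLineNeg`,
registry twist_split v12, case I of T2B-g17 §5); no stub is closed here; items 20428 / 19708 / 27893 OPEN.
-/

noncomputable section

set_option linter.dupNamespace false
set_option linter.style.longLine false

namespace Summit.NavierStokesRegularity.NavierStokesRegularity.Theorems.PoloidalWindowDoorLrcModEntireQ4SonicSheetSpeedLaw

open Set Function Filter Topology Metric
open scoped RealInnerProductSpace InnerProductSpace Laplacian ContDiff
open Literature.Analysis Literature.Analysis.FluidPDE Literature.Analysis.UnboundedOperators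
open Summit.NavierStokesRegularity.NavierStokesRegularity.Theorems
open Summit.NavierStokesRegularity.NavierStokesRegularity.Theorems.LocalSineTubeDoorProfileAlignedWindowRigidityAncient
open Summit.NavierStokesRegularity.NavierStokesRegularity.Theorems.PoloidalWindowDoorPoloidalWindowRigidityWindow
open Summit.NavierStokesRegularity.NavierStokesRegularity.Theorems.PoloidalWindowDoorPoloidalWindowRigidityLocalFrozenLaw
open Summit.NavierStokesRegularity.NavierStokesRegularity.Theorems.PoloidalWindowDoorPoloidalWindowRigidityTimeHeightShearLinearSlice
open Summit.NavierStokesRegularity.NavierStokesRegularity.Theorems.PoloidalWindowDoorPoloidalWindowRigidityConstantShearSlice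
open Summit.NavierStokesRegularity.NavierStokesRegularity.Theorems.PoloidalWindowDoorLrcModEntireTwistingTHHotPointPins
open Summit.NavierStokesRegularity.NavierStokesRegularity.Theorems.PoloidalWindowDoorLrcModEntireSheetFlattenTools
open Summit.NavierStokesRegularity.NavierStokesRegularity.Theorems.PoloidalWindowDoorLrcModEntireSheetTransport
open Summit.NavierStokesRegularity.NavierStokesRegularity.Theorems.PoloidalWindowDoorLrcModEntireParallelWebsIdentity
open Summit.NavierStokesRegularity.NavierStokesRegularity.Theorems.PoloidalWindowDoorLrcModEntireThreadPins
open Summit.NavierStokesRegularity.NavierStokesRegularity.Theorems.PoloidalWindowDoorLrcModEntireThreadPressure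
open Summit.NavierStokesRegularity.NavierStokesRegularity.Theorems.PoloidalWindowDoorLrcModEntireRidgeClassConstants
open Summit.NavierStokesRegularity.NavierStokesRegularity.Theorems.PoloidalWindowDoorLrcModEntireRidgeWebDynamics
open Summit.NavierStokesRegularity.NavierStokesRegularity.Theorems.PoloidalWindowDoorLrcModEntireTwistingTHFlatRidgeMixedPin
open Summit.NavierStokesRegularity.NavierStokesRegularity.Theorems.PoloidalWindowDoorLrcModEntireQ4SonicHotSheetSecondPins
open Summit.NavierStokesRegularity.NavierStokesRegularity.Theorems.PoloidalWindowDoorLrcModEntireQ4SonicHotSheetNormalForm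
open Summit.NavierStokesRegularity.NavierStokesRegularity.Theorems.PoloidalWindowDoorLrcModEntireQ4SonicSheetSpeedClass
open Summit.NavierStokesRegularity.NavierStokesRegularity.Theorems.PoloidalWindowDoorLrcModEntireQ4SonicSheetSpeed
open Summit.NavierStokesRegularity.NavierStokesRegularity.Theorems.PoloidalWindowDoorLrcModEntireQ4SonicSheetNonHot
open Summit.NavierStokesRegularity.NavierStokesRegularity.Theorems.PoloidalWindowDoorLrcModEntireQ4SonicHotSheetJet

variable {C : ℝ} {U : ℝ → EuclideanSpace ℝ (Fin 3) → EuclideanSpace ℝ (Fin 3)} {μ : ℝ → ℝ → ℝ} {ρ τ : ℝ} {e : EuclideanSpace ℝ (Fin 3)} {I : Set ℝ}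
  {d : ℝ → ℝ} {c : EuclideanSpace ℝ (Fin 3) →L[ℝ] ℝ}

/-- The height of a point of the straight parallel web sheet: `(s·e + d(z)·Je + z·e₂)₂ = z` for horizontal `e`. -/
theorem sheetPoint_two (he2 : e 2 = 0) (s n z : ℝ) : (s • e + n • Jvec e + z • e2) 2 = z := by
  simp [Jvec, e2, he2]

/-- ★ **THE NORMAL DERIVATIVE OF `∂ₜU₂` ON A NON-HOT SONIC SHEET OF PARALLEL LINES (every term explicit).**  See the module docstring for the setting.  With
`θ = U₂(t,·)`, `t = −1+τ`, `W = s·e + d(z)·Je + z·e₂`, `a = D²θ(W)[Je,Je] ≠ 0`: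
`D(∂ₜU₂(t,·))(W)[Je] = (1 + d′(z)²)·D³θ(W)[Je,Je,Je] − a·(U(t,W)₁e₀ − U(t,W)₀e₁ − d′(z)·U₂(t,W)) + 2·∂_zμ(t,z)·d′(z)·a/(1 − μ(t,z))`. -/
theorem sonic_sheet_normalDeriv_timeDeriv
    (hrate : HasTypeITimeDecay C U) (hcont : ContinuousOn (uncurry U) (Iio (0 : ℝ) ×ˢ univ))
    (hmild : ∀ s t : ℝ, s < t → t < 0 → ∀ x, U t x = heatExtension (U s) (t - s) x - oseenDuhamel 1 s U U t x)
    (hdiv : ∀ t < 0, VectorCalculus.IsDivFree (U t))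
    (hpol : ∀ s < 0, ∀ y, ⟪curl (U s) y, EuclideanSpace.single 2 1⟫_ℝ = 0)
    (hμ3 : ContDiff ℝ 3 (uncurry μ))
    (hslabU : ∀ t : ℝ, |t + 1| < ρ → ∀ x : EuclideanSpace ℝ (Fin 3), |x 2| < ρ → ∀ b : Fin 3, b ≠ 2 →
      fderiv ℝ (U t) x (EuclideanSpace.single 2 1) b = μ t (x 2) * fderiv ℝ (U t) x (EuclideanSpace.single b 1) 2)
    (hτ : |τ| < 1 / 2) (hτρ : |τ| < ρ) (he2 : e 2 = 0) (hunit : e 0 ^ 2 + e 1 ^ 2 = 1)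
    (hI : IsOpen I) (hIρ : ∀ z ∈ I, |z| < ρ) (hd : ContDiffOn ℝ ∞ d I)
    (hch : ∀ w : EuclideanSpace ℝ (Fin 3), w 2 = 0 → c w = 0)
    (hsheet : ∀ s : ℝ, ∀ z ∈ I, fderiv ℝ (fun y => U (-1 + τ) y 2) (s • e + d z • Jvec e + z • e2) = c)
    (hQ0 : ∀ z ∈ I, deriv d z ^ 2 + μ (-1 + τ) z = 0) (s : ℝ) {z : ℝ} (hz : z ∈ I)
    (ha : fderiv ℝ (fderiv ℝ (fun y => U (-1 + τ) y 2)) (s • e + d z • Jvec e + z • e2) (Jvec e) (Jvec e) ≠ 0) :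
    fderiv ℝ (fun x => deriv (fun s' => U s' x 2) (-1 + τ)) (s • e + d z • Jvec e + z • e2) (Jvec e) =
      (1 + deriv d z ^ 2) * fderiv ℝ (fderiv ℝ (fderiv ℝ (fun y => U (-1 + τ) y 2))) (s • e + d z • Jvec e + z • e2) (Jvec e) (Jvec e) (Jvec e)
        - fderiv ℝ (fderiv ℝ (fun y => U (-1 + τ) y 2)) (s • e + d z • Jvec e + z • e2) (Jvec e) (Jvec e) *
            (U (-1 + τ) (s • e + d z • Jvec e + z • e2) 1 * e 0 - U (-1 + τ) (s • e + d z • Jvec e + z • e2) 0 * e 1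
              - deriv d z * U (-1 + τ) (s • e + d z • Jvec e + z • e2) 2)
        + 2 * deriv (μ (-1 + τ)) z * deriv d z *
            fderiv ℝ (fderiv ℝ (fun y => U (-1 + τ) y 2)) (s • e + d z • Jvec e + z • e2) (Jvec e) (Jvec e) / (1 - μ (-1 + τ) z) := by
  set t : ℝ := -1 + τ with ht_def
  have ht : t < 0 := by rw [ht_def]; linarith [(abs_lt.1 hτ).2]
  have htρ : |t + 1| < ρ := by rw [ht_def]; simpa using hτρ
  set θ : EuclideanSpace ℝ (Fin 3) → ℝ := fun y => U t y 2 with hθ_def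
  set W : EuclideanSpace ℝ (Fin 3) := s • e + d z • Jvec e + z • e2 with hW_def
  have hW2 : W 2 = z := sheetPoint_two he2 s (d z) z
  /- regularity of the slice -/
  have hUan : AnalyticOnNhd ℝ (U t) univ := analyticOnNhd_slice hcont (bdd_of_hasTypeITimeDecay hrate) hmild ht
  have hU2 : ContDiff ℝ 2 (U t) := hUan.contDiff.of_le le_top
  have hθan : AnalyticOnNhd ℝ θ univ := fun x _ =>
    ((EuclideanSpace.proj (𝕜 := ℝ) (2 : Fin 3)).analyticAt _).comp (hUan x (mem_univ _))
  have hθ : ContDiff ℝ ∞ θ := hθan.contDiff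
  have hθ3 : ContDiff ℝ 3 θ := hθ.of_le (by norm_cast)
  have hθ2 : ContDiff ℝ 2 θ := hθ.of_le (by norm_cast)
  /- regularity of the offset -/
  have hIz : I ∈ 𝓝 z := hI.mem_nhds hz
  have hdAt : ∀ z' ∈ I, DifferentiableAt ℝ d z' := fun z' hz' =>
    (hd.differentiableOn (by simp)).differentiableAt (hI.mem_nhds hz')
  have hd' : ∀ᶠ z' in 𝓝 z, DifferentiableAt ℝ d z' := by
    filter_upwards [hIz] with z' hz' using hdAt z' hz'
  have hdD : ContDiffOn ℝ 1 (deriv d) I := hd.deriv_of_isOpen hI (by norm_cast)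
  have hd2 : HasDerivAt (deriv d) (deriv (deriv d) z) z :=
    ((hdD.differentiableOn one_ne_zero).differentiableAt hIz).hasDerivAt
  /- the sheet in `webMap` form and the constancy of the gradient near every sheet point -/
  have hWq : ∀ q : ℝ × ℝ, webMap e (fun q : ℝ × ℝ => d q.2) q = q.1 • e + d q.2 • Jvec e + q.2 • e2 := fun q => rfl
  have hconstAt : ∀ z' ∈ I, ∀ s' : ℝ, ∀ᶠ q in 𝓝 ((s', z') : ℝ × ℝ), fderiv ℝ θ (webMap e (fun q : ℝ × ℝ => d q.2) q) = c := by
    intro z' hz' s'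
    have hmem : {q : ℝ × ℝ | q.2 ∈ I} ∈ 𝓝 ((s', z') : ℝ × ℝ) := continuous_snd.continuousAt.preimage_mem_nhds (hI.mem_nhds hz')
    filter_upwards [hmem] with q hq
    rw [hWq]
    exact hsheet q.1 q.2 hq
  /- (i) null tangents along the sheet, (ii) `D³θ[e,e,Je] = 0`, (iii) the rank-one normal form at `W` -/
  have hnullT : ∀ᶠ z' in 𝓝 z, ∀ w, fderiv ℝ (fderiv ℝ θ) (s • e + d z' • Jvec e + z' • e2) (deriv d z' • Jvec e + e2) w = 0 := by
    filter_upwards [hIz] with z' hz' w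
    have h := (nonhot_sheet_null_tangents hθ2 e (p := (s, z')) (hdAt z' hz') (hconstAt z' hz' s)).2.2 w
    simpa [hWq] using h
  have h3e : fderiv ℝ (fderiv ℝ (fderiv ℝ θ)) W e e (Jvec e) = 0 := by
    -- (= `…Q4SonicSheetNonHot.nonhot_sheet_thirdDeriv_ee_eq_zero`; inlined: `e = DW(1,0)` is null along the sheet near `(s,z)`)
    set G : ℝ × ℝ → ℝ := fun q => d q.2 with hG
    have hGd : ∀ q : ℝ × ℝ, DifferentiableAt ℝ d q.2 → HasFDerivAt G ((ContinuousLinearMap.smulRight (1 : ℝ →L[ℝ] ℝ) (deriv d q.2)).comp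
        (ContinuousLinearMap.snd ℝ ℝ ℝ)) q := fun q hq => hq.hasDerivAt.hasFDerivAt.comp q hasFDerivAt_snd
    have hmem : {q : ℝ × ℝ | q.2 ∈ I} ∈ 𝓝 ((s, z) : ℝ × ℝ) := continuous_snd.continuousAt.preimage_mem_nhds hIz
    have hnull : ∀ᶠ q in 𝓝 ((s, z) : ℝ × ℝ), fderiv ℝ (fderiv ℝ θ) (webMap e G q) e = 0 := by
      filter_upwards [hmem] with q hq
      ext w'
      have h := (nonhot_sheet_null_tangents hθ2 e (p := q) (hdAt q.2 hq) (hconstAt q.2 hq q.1)).2.1 w'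
      simpa using h
    have hWd : DifferentiableAt ℝ (webMap e G) (s, z) := (hasFDerivAt_webMap e (hGd (s, z) (hdAt z hz)).differentiableAt).differentiableAt
    have h := thirdDeriv_apply_eq_zero_of_hessian_null_sheet hθ3 hWd hnull ((1 : ℝ), (0 : ℝ)) (Jvec e)
    rw [fderiv_webMap_apply e (hGd (s, z) (hdAt z hz)).differentiableAt, (hGd (s, z) (hdAt z hz)).fderiv] at h
    simpa [hWq] using h
  have hnf1 : ∀ u w : EuclideanSpace ℝ (Fin 3), fderiv ℝ (fderiv ℝ θ) W u w =
      fderiv ℝ (fderiv ℝ θ) W (Jvec e) (Jvec e) * ((u 1 * e 0 - u 0 * e 1 - deriv d z * u 2) * (w 1 * e 0 - w 0 * e 1 - deriv d z * w 2)) :=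
    fun u w => (nonhot_sheet_hessian_normalForm hθ2 he2 hunit (p := (s, z)) (hdAt z hz) (hconstAt z hz s) u w).1
  have hnf2 : fderiv ℝ (fderiv ℝ θ) W (Jvec e) e2 = -deriv d z * fderiv ℝ (fderiv ℝ θ) W (Jvec e) (Jvec e) :=
    (nonhot_sheet_hessian_normalForm hθ2 he2 hunit (p := (s, z)) (hdAt z hz) (hconstAt z hz s) (Jvec e) e2).2
  /- (iv) the transport law `(d′a²)′ = 0` along the web at time `t` -/
  have hμfun : μ t = uncurry μ ∘ fun z : ℝ => (t, z) := by funext z; rfl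
  have hμd : ∀ z ∈ I, DifferentiableAt ℝ (μ t) z := fun z _ => by
    rw [hμfun]; exact ((hμ3.differentiable (by norm_num)) _).comp z ((differentiableAt_const _).prodMk differentiableAt_id)
  have hplane : ∀ z : ℝ, |z| < ρ → ∀ y : EuclideanSpace ℝ (Fin 3), y 2 = z → ∀ b : Fin 3, b ≠ 2 →
      fderiv ℝ (U t) y (EuclideanSpace.single 2 (1 : ℝ)) b = μ t z * fderiv ℝ (U t) y (EuclideanSpace.single b (1 : ℝ)) 2 := by
    intro z hz y hy b hb
    have h := hslabU t htρ y (by rw [hy]; exact hz) b hb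
    rw [hy] at h; exact h
  have hlawI : ∀ x : EuclideanSpace ℝ (Fin 3), x 2 ∈ I →
      fderiv ℝ (fun y => fderiv ℝ θ y (EuclideanSpace.single 2 (1 : ℝ))) x (EuclideanSpace.single 2 (1 : ℝ)) =
        -μ t (x 2) * (fderiv ℝ (fun y => fderiv ℝ θ y (EuclideanSpace.single 0 (1 : ℝ))) x (EuclideanSpace.single 0 (1 : ℝ)) +
          fderiv ℝ (fun y => fderiv ℝ θ y (EuclideanSpace.single 1 (1 : ℝ))) x (EuclideanSpace.single 1 (1 : ℝ))) := fun x hx =>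
    plane_wave_identity hU2 (fun y => div_coord (hdiv t ht) y) (hplane (x 2) (hIρ _ hx)) rfl
  have hwebI : ∀ s : ℝ, ∀ z ∈ I, fderiv ℝ θ (s • e + d z • Jvec e + z • e2) (Jvec e) = 0 := by
    intro s' z' hz'
    rw [hsheet s' z' hz']
    exact hch _ (by simp [Jvec])
  have htr : HasDerivAt (fun z' : ℝ => deriv d z' * (fderiv ℝ (fderiv ℝ θ) (s • e + d z' • Jvec e + z' • e2) (Jvec e) (Jvec e)) ^ 2) 0 z :=
    transport_on_characteristic_sheet hθ hI hμd hd he2 hunit hlawI hwebI hQ0 s hz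
  /- (v) `D(Δθ)(W)[Je] = (1+d′²)·a₃` -/
  have hΔ := laplacian_normalDeriv_of_sonicSheet hθ3 he2 hunit hd' hd2 hnullT h3e htr ha
  /- (vi) the source identity at the horizontally critical point `W` -/
  have hslope : ∀ y : EuclideanSpace ℝ (Fin 3), y 2 = W 2 →
      ∀ᶠ q in 𝓝 ((t, y) : ℝ × EuclideanSpace ℝ (Fin 3)), ∀ b : Fin 3, b ≠ 2 →
        fderiv ℝ (U q.1) q.2 (EuclideanSpace.single 2 1) b = μ q.1 (q.2 2) * fderiv ℝ (U q.1) q.2 (EuclideanSpace.single b 1) 2 := by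
    intro y hy
    have hO : IsOpen {q : ℝ × EuclideanSpace ℝ (Fin 3) | |q.1 + 1| < ρ ∧ |q.2 2| < ρ} := by
      refine IsOpen.and ?_ ?_
      · exact isOpen_lt (continuous_abs.comp (continuous_fst.add continuous_const)) continuous_const
      · exact isOpen_lt (continuous_abs.comp ((EuclideanSpace.proj (𝕜 := ℝ) (2 : Fin 3)).continuous.comp continuous_snd)) continuous_const
    have hmem : ((t, y) : ℝ × EuclideanSpace ℝ (Fin 3)) ∈ {q : ℝ × EuclideanSpace ℝ (Fin 3) | |q.1 + 1| < ρ ∧ |q.2 2| < ρ} := by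
      refine ⟨htρ, ?_⟩
      show |y 2| < ρ
      rw [hy, hW2]; exact hIρ z hz
    filter_upwards [hO.mem_nhds hmem] with q hq b hb
    exact hslabU q.1 hq.1 q.2 hq.2 b hb
  have hμz : μ t (W 2) = μ t z := by rw [hW2]
  have hμ1 : μ t (W 2) ≠ 1 := by
    rw [hμz]; intro h1
    have h := hQ0 z hz
    rw [h1] at h
    nlinarith [sq_nonneg (deriv d z)]
  have hgradh : ∀ w : EuclideanSpace ℝ (Fin 3), w 2 = 0 → fderiv ℝ θ W w = 0 := by
    intro w hw
    rw [hW_def, hsheet s z hz]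
    exact hch w hw
  have hsrc := normalDeriv_timeDeriv_of_horizCritical hrate hcont hmild hdiv hpol hμ3 ht hslope hμ1 hgradh e
  /- (vii) assemble -/
  rw [hsrc, hΔ, hnf1 (Jvec e) (U t W), show EuclideanSpace.single 2 (1 : ℝ) = e2 from rfl, hnf2, hW2]
  have hsq : e 0 * e 0 + e 1 * e 1 = 1 := by nlinarith [hunit]
  have hJ : (Jvec e) 1 * e 0 - (Jvec e) 0 * e 1 - deriv d z * (Jvec e) 2 = 1 := by
    simp [Jvec]; linarith [hsq]
  rw [hJ]
  ring

/-- ★★ **THE WEB-SPEED LAW ON A NON-HOT SONIC SHEET OF PARALLEL LINES (B-SPEEDτ of T2B-g17 §5(5g)).**  Under the hypotheses of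
`sonic_sheet_normalDeriv_timeDeriv`, `σ = ±1`, and the kinematic sheet-speed law with normal speed `V` at `(τ, W)` (the space–time Hessian of
`(a,y) ↦ σU₂(−1+a,y)` kills `((1, V·Je), (0, Je))` — `…RidgeWebCurves.spacetimeHessian_sheetVelocity_normal_eq_zero`):
`V·a = −(1 + d′(z)²)·D³θ(W)[Je,Je,Je] + a·(U(t,W)₁e₀ − U(t,W)₀e₁ − d′(z)·U₂(t,W)) − 2·∂_zμ(t,z)·d′(z)·a/(1 − μ(t,z))`, `a = D²θ(W)[Je,Je]`, `θ = U₂(t,·)`. -/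
theorem sonic_sheet_speed_law
    (hrate : HasTypeITimeDecay C U) (hcont : ContinuousOn (uncurry U) (Iio (0 : ℝ) ×ˢ univ))
    (hmild : ∀ s t : ℝ, s < t → t < 0 → ∀ x, U t x = heatExtension (U s) (t - s) x - oseenDuhamel 1 s U U t x)
    (hdiv : ∀ t < 0, VectorCalculus.IsDivFree (U t))
    (hpol : ∀ s < 0, ∀ y, ⟪curl (U s) y, EuclideanSpace.single 2 1⟫_ℝ = 0)
    (hμ3 : ContDiff ℝ 3 (uncurry μ))
    (hslabU : ∀ t : ℝ, |t + 1| < ρ → ∀ x : EuclideanSpace ℝ (Fin 3), |x 2| < ρ → ∀ b : Fin 3, b ≠ 2 →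
      fderiv ℝ (U t) x (EuclideanSpace.single 2 1) b = μ t (x 2) * fderiv ℝ (U t) x (EuclideanSpace.single b 1) 2)
    (hτ : |τ| < 1 / 2) (hτρ : |τ| < ρ) (he2 : e 2 = 0) (hunit : e 0 ^ 2 + e 1 ^ 2 = 1)
    (hI : IsOpen I) (hIρ : ∀ z ∈ I, |z| < ρ) (hd : ContDiffOn ℝ ∞ d I)
    (hch : ∀ w : EuclideanSpace ℝ (Fin 3), w 2 = 0 → c w = 0)
    (hsheet : ∀ s : ℝ, ∀ z ∈ I, fderiv ℝ (fun y => U (-1 + τ) y 2) (s • e + d z • Jvec e + z • e2) = c)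
    (hQ0 : ∀ z ∈ I, deriv d z ^ 2 + μ (-1 + τ) z = 0) (s : ℝ) {z : ℝ} (hz : z ∈ I)
    (ha : fderiv ℝ (fderiv ℝ (fun y => U (-1 + τ) y 2)) (s • e + d z • Jvec e + z • e2) (Jvec e) (Jvec e) ≠ 0)
    {σ : ℝ} (hσ : σ = 1 ∨ σ = -1) {V : ℝ}
    (hkin : fderiv ℝ (fderiv ℝ (uncurry fun a y => σ * U (-1 + a) y 2)) (τ, s • e + d z • Jvec e + z • e2) ((1 : ℝ), V • Jvec e) ((0 : ℝ), Jvec e) = 0) :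
    V * fderiv ℝ (fderiv ℝ (fun y => U (-1 + τ) y 2)) (s • e + d z • Jvec e + z • e2) (Jvec e) (Jvec e) =
      -((1 + deriv d z ^ 2) * fderiv ℝ (fderiv ℝ (fderiv ℝ (fun y => U (-1 + τ) y 2))) (s • e + d z • Jvec e + z • e2) (Jvec e) (Jvec e) (Jvec e))
        + fderiv ℝ (fderiv ℝ (fun y => U (-1 + τ) y 2)) (s • e + d z • Jvec e + z • e2) (Jvec e) (Jvec e) *
            (U (-1 + τ) (s • e + d z • Jvec e + z • e2) 1 * e 0 - U (-1 + τ) (s • e + d z • Jvec e + z • e2) 0 * e 1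
              - deriv d z * U (-1 + τ) (s • e + d z • Jvec e + z • e2) 2)
        - 2 * deriv (μ (-1 + τ)) z * deriv d z *
            fderiv ℝ (fderiv ℝ (fun y => U (-1 + τ) y 2)) (s • e + d z • Jvec e + z • e2) (Jvec e) (Jvec e) / (1 - μ (-1 + τ) z) := by
  have hmain := sonic_sheet_normalDeriv_timeDeriv hrate hcont hmild hdiv hpol hμ3 hslabU hτ hτρ he2 hunit hI hIρ hd hch hsheet hQ0 s hz ha
  set t : ℝ := -1 + τ with ht_def
  have ht : t < 0 := by rw [ht_def]; linarith [(abs_lt.1 hτ).2]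
  have h1 : t ∈ Iio (0 : ℝ) := ht
  set W : EuclideanSpace ℝ (Fin 3) := s • e + d z • Jvec e + z • e2 with hW_def
  -- g6's speed law against the time derivative
  have hg6 := sheetSpeed_eq_fderiv_timeDeriv hrate hcont hmild hdiv hσ hτ (y₀ := W) (ν := Jvec e) (V := V) hkin
  -- regularity and the two currency conversions
  have hA : IsTypeIAncientMild C U := isTypeIAncientMild_of_class hrate hcont hmild hdiv
  have hsm : IsSmoothSpaceTimeOn (Iio 0) U := hA.contDiffOn
  have hslice : ContDiff ℝ ∞ (U t) := hsm.contDiff_slice h1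
  have hθ2 : ContDiff ℝ 2 (fun y => U t y 2) := PoloidalWindowDoorPoloidalWindowRigidityConstantShearMeans.contDiff_coord (hslice.of_le (by norm_cast)) 2
  have hconv1 : fderiv ℝ (fderiv ℝ (fun y => σ * U t y 2)) W (Jvec e) (Jvec e) = σ * fderiv ℝ (fderiv ℝ (fun y => U t y 2)) W (Jvec e) (Jvec e) :=
    fderiv_fderiv_const_mul_apply hθ2 σ W (Jvec e) (Jvec e)
  have hconv2 : (fun y : EuclideanSpace ℝ (Fin 3) => (timeDerivWithin (Iio 0) U t y) 2) = fun y => deriv (fun s' => U s' y 2) t := by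
    funext y
    rw [timeDerivWithin_eq_deriv isOpen_Iio h1 U y, deriv_apply_coord (hsm.hasDerivAt_timeLine isOpen_Iio h1 y).differentiableAt 2]
  rw [hconv1, hconv2, hmain] at hg6
  have hσσ : σ * σ = 1 := by rcases hσ with h | h <;> simp [h]
  set a := fderiv ℝ (fderiv ℝ (fun y => U t y 2)) W (Jvec e) (Jvec e) with ha_def
  set X := (1 + deriv d z ^ 2) * fderiv ℝ (fderiv ℝ (fderiv ℝ (fun y => U t y 2))) W (Jvec e) (Jvec e) (Jvec e)
        - a * (U t W 1 * e 0 - U t W 0 * e 1 - deriv d z * U t W 2)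
        + 2 * deriv (μ t) z * deriv d z * a / (1 - μ t z) with hX_def
  have hkey : V * a = -X := by
    have h : V * (σ * a) = -(σ * X) := hg6
    have h2 : σ * (V * (σ * a)) = σ * (-(σ * X)) := by rw [h]
    have h3 : V * a * (σ * σ) = -X * (σ * σ) := by linear_combination h2
    simpa [hσσ] using h3
  rw [hkey, hX_def]
  ring

end Summit.NavierStokesRegularity.NavierStokesRegularity.Theorems.PoloidalWindowDoorLrcModEntireQ4SonicSheetSpeedLaw
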